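import Summits.BirchSwinnertonDyer.Rank1Residual.Additive.SignedTwistSelmerInftyEta
import HarnessLib

/-!
# (T-O7ss-P5, file P5-5a) The `Λ`-dual transport, SAME module ((D5)):
# `X^{−,str}(W/ℚ_∞)` IS `X⁻(V/K₀ℚ_∞)^η`

Cell n1011 (b2b / bsd-rank1-residual), row T-O7ss-P13 follow-up (P5), skeleton
`cells/n1011/skel/T-O7ss-P5.md` §2 (D5); designs (A)/(B) approved (referee-1 GEN 22 ACK-1,
lead R5-69 (m) / R5-71; cc-typer-6 GEN 12 (Q1)–(Q4): (Q3) consumer chain confirmed).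

HONEST FRAMING. The programme this file serves is a CONDITIONAL ASSEMBLY of the
Birch–Swinnerton-Dyer formula for ALL analytic-rank `≤ 1` elliptic curves over `ℚ` — "full BSD
formula for every rank `≤ 1` curve in class `C`" assembled STRICTLY from published theorems — so
that the rank-`≤ 1` remainder becomes exactly the CONSTRUCTION-SHAPED classes, which are TYPED
(missing-input `Prop`s), NOT attempted. This is not "finishing BSD". Research route on
O7-ss ∩ (G)∧ss ∩ e = 2 (OPEN) / X4 CONSTRUCTION-SHAPED; nothing here is booked; no label moves.
TOOL DEFINITIONS + THEOREMS ONLY (definition lane: TWO `def`s — the Selmer-level isomorphism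
`strictSignedSelmerInftyEquivEta` packaged from (D3), and the transport of dual data
`StrictSignedSelmerDualData.toEtaSigned` with the SAME module, `toEtaSigned_X : _ = D.X := rfl`);
no named Literature fact, no `sorry`; axioms standard.

Binders: `hD` = (D0) at `closureEmb E`; `hκ₀` (RESHAPE, P5-2a: `κ(Gal(ℚ̄/K₀)) = ℤ_p`);
`hcop : p ∤ [Γ_ℚ : Gal(ℚ̄/K₀)]`; `[(galRange K₀).Normal]`; `hη`; for the dual transport
`γ' ∈ Gal(ℚ̄/K₀)` with `γ⁻¹γ' ∈ ker κ` (the consumer's `T = γ − 1` on the `W`-side becomes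
cc-typer-6's `T = γ' − 1`, `γ' ∈ Γ = Gal(K_∞/K₀)`). No `p ≠ 2`, no `IsElliptic` (binder diff vs.
the GEN 6 signature scratch 6d7079126fd5332b: `[W.IsElliptic] [V.IsElliptic]` DROPPED, `hκ₀`
ADDED, `LocalTowerHyp` unfolded as `hD`).

## What is defined / proved
* `strictSignedSelmerInftyEquivEta : Sel^{−,str}(W/ℚ_∞) ≃+ Sel⁻(V/K₀ℚ_∞)^η` (from (D3) and the
  injectivity of `Θ_∞`), `coe_strictSignedSelmerInftyEquivEta` (it IS `Θ_∞`),
  `h1TransportInfty_symm_apply`, `coe_strictSignedSelmerInftyEquivEta_conjH1`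
  (`Θ_∞ (g_* s) = η(g) · g_* (Θ_∞ s)`), `conjH1_eq_eta_smul_conjH1_of_mem_eta`
  (`conj_{γ'} = η(γ) · conj_γ` on the `η`-component);
* **`StrictSignedSelmerDualData.toEtaSigned`**: a Pontryagin-dual datum of `Sel^{−,str}(W/ℚ_∞)` at
  `γ` IS an `η`-signed dual datum of `V` over `K₀ℚ_∞` at `γ'`, with the SAME `Λ`-module
  (`toEtaSigned_X`, `toEtaSigned_charIdeal`: `rfl`).

References: S. Kobayashi, Invent. Math. 152 (2003) Def. 2.1, §3 p. 5 (`γ ↔ 1 + X`), §4 p. 8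
(`X⁻(E/K_∞)^η`) [Kobayashi2003]; R. Greenberg, LNM 1716 (1999) §1 p. 60 (the `Λ`-module
structure on Pontryagin duals) [GreenbergLNM1716].
-/

noncomputable section

open scoped Classical

open WeierstrassCurve Field

namespace Summit.BirchSwinnertonDyer.Rank1Residual.Additive.SignedTwist

open Literature.NumberTheory.EllipticCurves Literature.NumberTheory.GaloisRepresentations
  Literature.NumberTheory.EllipticCurves.Kobayashi2003
  Summit.BirchSwinnertonDyer.Rank1Residual.AdditivePotMult ZpExtension

/-! ## §1 `Sel^{−,str}(W/ℚ_∞) ≃+ Sel⁻(V/K₀ℚ_∞)^η` -/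

section Frame

variable (W : WeierstrassCurve ℚ) (K₀ : Type) [Field K₀] [NumberField K₀] {θ : K₀} {c : ℚ}
  (hθ : θ ∉ Set.range (algebraMap ℚ K₀)) (hc : θ ^ 2 = algebraMap ℚ K₀ c)
  (p : ℕ) [Fact p.Prime] (κ : ZpExtension ℚ p)
  {V : WeierstrassCurve ℚ} {C : VariableChange ℚ} (hCV : C • W.quadraticTwist c = V)
  (η : absoluteGaloisGroup ℚ →* ℤˣ)
  (hη : ∀ σ : absoluteGaloisGroup ℚ, η σ = 1 ↔ σ • rootInClosure K₀ θ = rootInClosure K₀ θ)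
  (E : Type) [Field E] [Algebra ℚ E] [(galRange (K := ℚ) K₀).Normal]
  (hD : ∀ g : absoluteGaloisGroup ℚ, ∃ τ : absoluteGaloisGroup E,
    (resGalOfEmb (closureEmb (K := ℚ) E) τ)⁻¹ * g ∈ towerTopSubgroup κ K₀)
  (hκ₀ : ∀ x, ∃ g ∈ galRange (K := ℚ) K₀, κ g = x)
  (hcop : (galRange (K := ℚ) K₀).index.Coprime p)

/-- **The Selmer-level `η`-twist dictionary as an isomorphism**
`Sel^{−,str}(W/ℚ_∞) ≃+ Sel⁻(V/K₀ℚ_∞)^η`: `Θ_∞` is injective (`h1TransportInfty_injective`) with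
image the `η`-component ((D3), `map_h1TransportInfty_strictSignedSelmerInfty`).
[cite: Kobayashi2003, Def. 2.1 (p. 5), §4 p. 8 (X⁻(E/K_∞)^η)] -/
def strictSignedSelmerInftyEquivEta :
    strictSignedSelmerInfty W κ E (-1) ≃+ towerSignedSelmerInftyEta V κ K₀ E η (-1) :=
  ((strictSignedSelmerInfty W κ E (-1)).equivMapOfInjective (h1TransportInfty W K₀ hθ hc p κ hCV)
      (h1TransportInfty_injective W K₀ hθ hc p κ hCV hcop)).trans
    (AddEquiv.addSubgroupCongr
      (map_h1TransportInfty_strictSignedSelmerInfty W K₀ hθ hc p κ hCV E η hη hD hκ₀ hcop))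

/-- The isomorphism IS `Θ_∞` on underlying classes. [cite: Kobayashi2003, Def. 2.1 (p. 5)] -/
theorem coe_strictSignedSelmerInftyEquivEta (s : strictSignedSelmerInfty W κ E (-1)) :
    ((strictSignedSelmerInftyEquivEta W K₀ hθ hc p κ hCV η hη E hD hκ₀ hcop s :
        towerSignedSelmerInftyEta V κ K₀ E η (-1)) : V.subgroupH1 p (towerTopSubgroup κ K₀)) =
      h1TransportInfty W K₀ hθ hc p κ hCV s :=
  rfl

/-- `Θ_∞` of the inverse image is the class itself. [cite: Kobayashi2003, Def. 2.1 (p. 5)] -/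
theorem h1TransportInfty_symm_apply (t : towerSignedSelmerInftyEta V κ K₀ E η (-1)) :
    h1TransportInfty W K₀ hθ hc p κ hCV
        ((strictSignedSelmerInftyEquivEta W K₀ hθ hc p κ hCV η hη E hD hκ₀ hcop).symm t :
          strictSignedSelmerInfty W κ E (-1)) =
      (t : V.subgroupH1 p (towerTopSubgroup κ K₀)) := by
  rw [← coe_strictSignedSelmerInftyEquivEta W K₀ hθ hc p κ hCV η hη E hD hκ₀ hcop,
    AddEquiv.apply_symm_apply]

/-- **Galois bookkeeping**: `Θ_∞ (g_* s) = η(g) · g_* (Θ_∞ s)` for every `g ∈ Γ_ℚ`, on the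
strict signed Selmer group. [cite: Kobayashi2003, §4 p. 8] -/
theorem coe_strictSignedSelmerInftyEquivEta_conjH1 (g : absoluteGaloisGroup ℚ)
    (s : strictSignedSelmerInfty W κ E (-1)) :
    ((strictSignedSelmerInftyEquivEta W K₀ hθ hc p κ hCV η hη E hD hκ₀ hcop
        ⟨W.conjH1 p κ.kerSubgroup g s, conjH1_mem_strictSignedSelmerInfty W κ E (-1) g s.2⟩ :
        towerSignedSelmerInftyEta V κ K₀ E η (-1)) : V.subgroupH1 p (towerTopSubgroup κ K₀)) =
      ((η g : ℤˣ) : ℤ) • V.conjH1 p (towerTopSubgroup κ K₀) g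
        ((strictSignedSelmerInftyEquivEta W K₀ hθ hc p κ hCV η hη E hD hκ₀ hcop s :
          towerSignedSelmerInftyEta V κ K₀ E η (-1)) : V.subgroupH1 p (towerTopSubgroup κ K₀)) := by
  rw [coe_strictSignedSelmerInftyEquivEta, coe_strictSignedSelmerInftyEquivEta]
  exact h1TransportInfty_conjH1 W K₀ hθ hc p κ hCV η hη g s

include hη in
/-- **`conj_{γ'} = η(γ) · conj_γ` on the `η`-component** for `γ' ∈ Gal(ℚ̄/K₀)` with
`γ⁻¹γ' ∈ ker κ`: `conj_{γ'} t = conj_γ (conj_{γ⁻¹γ'} t) = η(γ⁻¹γ') · conj_γ t` and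
`η(γ⁻¹γ') = η(γ)⁻¹ η(γ') = η(γ)` (`η(γ') = 1`: `Gal(ℚ̄/K₀)` fixes `θ`).
[cite: Kobayashi2003, §4 p. 8 (M^η = ε_η M), §3 p. 5] -/
theorem conjH1_eq_eta_smul_conjH1_of_mem_eta {γ γ' : absoluteGaloisGroup ℚ}
    (hγ' : γ' ∈ galRange (K := ℚ) K₀) (hγγ' : γ⁻¹ * γ' ∈ κ.kerSubgroup)
    {t : V.subgroupH1 p (towerTopSubgroup κ K₀)} (ht : t ∈ towerSignedSelmerInftyEta V κ K₀ E η (-1)) :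
    V.conjH1 p (towerTopSubgroup κ K₀) γ' t =
      ((η γ : ℤˣ) : ℤ) • V.conjH1 p (towerTopSubgroup κ K₀) γ t := by
  have hηγ' : η γ' = 1 := (hη γ').mpr (apply_rootInClosure_of_mem K₀ hγ')
  have hη2 : η (γ⁻¹ * γ') = η γ := by
    rw [map_mul, map_inv, hηγ', mul_one, Int.units_inv_eq_self]
  have h1 : γ' = γ * (γ⁻¹ * γ') := (mul_inv_cancel_left γ γ').symm
  conv_lhs => rw [h1]
  rw [V.conjH1_mul_holds p (towerTopSubgroup κ K₀) γ (γ⁻¹ * γ'), AddMonoidHom.comp_apply,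
    ht.2 _ hγγ', map_zsmul, hη2]

/-! ## §2 The dual transport: SAME module -/

/-- **`X^{−,str}(W/ℚ_∞)` IS `X⁻(V/K₀ℚ_∞)^η` (D5)**: a Pontryagin-dual datum `D` of
`Sel^{−,str}(W/ℚ_∞)` at `γ` (p17 F2a `StrictSignedSelmerDualData`) IS an `η`-signed dual datum
of `V` over `K_∞ = K₀ℚ_∞` at any `γ' ∈ Gal(ℚ̄/K₀)` with `γ⁻¹γ' ∈ ker κ` (cc-typer-6's
`EtaSignedSelmerDualData`), with the SAME underlying `Λ`-module `D.X`: the character group is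
re-indexed along `strictSignedSelmerInftyEquivEta`, `T = γ − 1 ↦ T = γ' − 1` because
`conj_{γ'} = η(γ)·conj_γ` on the `η`-component matches `Θ_∞ ∘ conj_γ = η(γ)·conj_γ ∘ Θ_∞`,
and the constants act through `ℤ_p → ℤ/pᵏ` as before.
[cite: Kobayashi2003, Def. 2.1 (p. 5), §3 p. 5, §4 p. 8 (X⁻(E/K_∞)^η)] [cite: GreenbergLNM1716, §1 (p. 60)] -/
def _root_.Summit.BirchSwinnertonDyer.Rank1Residual.Additive.StrictSignedSelmerDualData.toEtaSigned
    {γ γ' : absoluteGaloisGroup ℚ} (hγ' : γ' ∈ galRange (K := ℚ) K₀)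
    (hγγ' : γ⁻¹ * γ' ∈ κ.kerSubgroup) (D : StrictSignedSelmerDualData W κ E γ (-1)) :
    EtaSignedSelmerDualData V κ K₀ E η γ' (-1) where
  X := D.X
  addCommGroup := D.addCommGroup
  module := D.module
  conj_mem := fun _ hs ↦ conjH1_mem_towerSignedSelmerInftyEta V κ K₀ E η (-1) γ' hs
  toDual := AddMonoidHom.mk'
    (fun x ↦ (D.toDual x).comp
      ((strictSignedSelmerInftyEquivEta W K₀ hθ hc p κ hCV η hη E hD hκ₀ hcop).symm :
        towerSignedSelmerInftyEta V κ K₀ E η (-1) →+ strictSignedSelmerInfty W κ E (-1)))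
    (fun x y ↦ by rw [map_add, AddMonoidHom.add_comp])
  bijective := by
    constructor
    · intro x y hxy
      apply D.bijective.1
      ext s
      have h := DFunLike.congr_fun hxy
        (strictSignedSelmerInftyEquivEta W K₀ hθ hc p κ hCV η hη E hD hκ₀ hcop s)
      change D.toDual x ((strictSignedSelmerInftyEquivEta W K₀ hθ hc p κ hCV η hη E hD hκ₀ hcop).symm
          (strictSignedSelmerInftyEquivEta W K₀ hθ hc p κ hCV η hη E hD hκ₀ hcop s)) =
        D.toDual y ((strictSignedSelmerInftyEquivEta W K₀ hθ hc p κ hCV η hη E hD hκ₀ hcop).symm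
          (strictSignedSelmerInftyEquivEta W K₀ hθ hc p κ hCV η hη E hD hκ₀ hcop s)) at h
      rwa [AddEquiv.symm_apply_apply] at h
    · intro φ
      obtain ⟨x, hx⟩ := D.bijective.2 (φ.comp
        (strictSignedSelmerInftyEquivEta W K₀ hθ hc p κ hCV η hη E hD hκ₀ hcop :
          strictSignedSelmerInfty W κ E (-1) →+ towerSignedSelmerInftyEta V κ K₀ E η (-1)))
      refine ⟨x, ?_⟩
      ext t
      change D.toDual x
          ((strictSignedSelmerInftyEquivEta W K₀ hθ hc p κ hCV η hη E hD hκ₀ hcop).symm t) = φ t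
      rw [hx, AddMonoidHom.comp_apply, AddMonoidHom.coe_coe, AddEquiv.apply_symm_apply]
  toDual_T_smul := fun x s ↦ by
    change D.toDual (PowerSeries.X • x) ((strictSignedSelmerInftyEquivEta W K₀ hθ hc p κ hCV η hη E hD hκ₀ hcop).symm s) =
      D.toDual x ((strictSignedSelmerInftyEquivEta W K₀ hθ hc p κ hCV η hη E hD hκ₀ hcop).symm
        ⟨V.conjH1 p (towerTopSubgroup κ K₀) γ' s, _⟩) -
      D.toDual x ((strictSignedSelmerInftyEquivEta W K₀ hθ hc p κ hCV η hη E hD hκ₀ hcop).symm s)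
    rw [D.toDual_T_smul x _]
    congr 2
    rw [eq_comm, AddEquiv.symm_apply_eq]
    apply Subtype.ext
    rw [coe_strictSignedSelmerInftyEquivEta_conjH1, AddEquiv.apply_symm_apply]
    exact conjH1_eq_eta_smul_conjH1_of_mem_eta K₀ p κ η hη E hγ' hγγ' s.2
  toDual_C_smul := fun c x s k hk ↦ by
    change D.toDual (PowerSeries.C c • x) ((strictSignedSelmerInftyEquivEta W K₀ hθ hc p κ hCV η hη E hD hκ₀ hcop).symm s) =
      (PadicInt.toZModPow k c).val • D.toDual x ((strictSignedSelmerInftyEquivEta W K₀ hθ hc p κ hCV η hη E hD hκ₀ hcop).symm s)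
    exact D.toDual_C_smul c x _ k (by rw [← map_nsmul, hk, map_zero])

/-- **SAME module, literally**: `(D.toEtaSigned …).X = D.X`. [cite: Kobayashi2003, §4 p. 8] -/
theorem _root_.Summit.BirchSwinnertonDyer.Rank1Residual.Additive.StrictSignedSelmerDualData.toEtaSigned_X
    {γ γ' : absoluteGaloisGroup ℚ} (hγ' : γ' ∈ galRange (K := ℚ) K₀)
    (hγγ' : γ⁻¹ * γ' ∈ κ.kerSubgroup) (D : StrictSignedSelmerDualData W κ E γ (-1)) :
    (D.toEtaSigned W K₀ hθ hc p κ hCV η hη E hD hκ₀ hcop hγ' hγγ').X = D.X :=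
  rfl

/-- Same characteristic ideal, literally. [cite: Kobayashi2003, §4 p. 8 (Char X⁻(E/K_∞)^η)] -/
theorem _root_.Summit.BirchSwinnertonDyer.Rank1Residual.Additive.StrictSignedSelmerDualData.toEtaSigned_charIdeal
    {γ γ' : absoluteGaloisGroup ℚ} (hγ' : γ' ∈ galRange (K := ℚ) K₀)
    (hγγ' : γ⁻¹ * γ' ∈ κ.kerSubgroup) (D : StrictSignedSelmerDualData W κ E γ (-1)) :
    (D.toEtaSigned W K₀ hθ hc p κ hCV η hη E hD hκ₀ hcop hγ' hγγ').charIdeal = D.charIdeal :=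
  rfl

end Frame

end Summit.BirchSwinnertonDyer.Rank1Residual.Additive.SignedTwist

end
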